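import Literature.MathematicalPhysics.QuantumFieldTheory.Balaban1983to89.Node00.TorusCoverLandau153TowerDoor
import Literature.MathematicalPhysics.QuantumFieldTheory.Balaban1983to89.Node00.TorusCoverSUGaugeLocalPhase
import Literature.MathematicalPhysics.QuantumFieldTheory.Balaban1983to89.Node00.TorusCoverLandau153REFiner

/-!
# NODE 00 — THE (152)+(153) TOWER DOOR WITH [6] PROPOSITION 6's MEMBER GAUGE EXPORTED (plan g90 RULING A2 = N1, Part I (d₂)): my g7 tower door
# (`TorusCoverLandau153Tower` → `…TowerWindow` → `…TowerDoor`) re-run from the `SU(N)`-valued ∃-body of N05's `Node00.GaugedBoundB8`, keeping conjuncts 2, 3 and 11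
# ([6] (1.29) corner normalisation, `u = 1` off `□₀`, (1.137)) and EXPORTING the identification of the torus gauge: `ιSU (u (π x)) = u_m(x)⁻¹ · v_fix(x)` on `□₀`, `A ∘ π =
# logCfg η (U″^{u_m⁻¹})` on `□̃` — the rows the K0 knit's `Nrm` text of record `NrmMem` (Summits `…N07NormalisationMember`) is made of

Cell `pub-ymgap`, width seat `pub-ymgap-dag-n07-w3` g8 (LEAD PEN of plan g90's SPEC D90-S3W1 (P1)(iii); RULING A2, cell bus 2026-08-29 I.44535: «(d) E4ᵐ door S1ᵐ = HS3NORM-67c's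
clause with `Nrm := Nrm_mem` from `GaugedBoundB8` conj. 3∕6∕7 + … by PUSH-DOWN ONLY»; Stage-0 reply `HOME/pub-ymgap-dag-n07-w3/SPEC-REPLY-P1iii.md` §1b∕§2 N1).  NEW leaf; CONSUMED
BY NAME, nothing modified: my g7 `Node00.TorusCoverLandau153Tower ∕ TowerWindow ∕ TowerDoor` (their proofs re-run VERBATIM with a longer `obtain` and a longer conclusion),
my g8 FILE 3b″ `Node00.TorusCoverSUGaugeLocalPhase.exists_suGauge_of_specialUnitaryGauge_local` (SU in ⇒ SU out, no phase), dag-n07-e's `TorusCoverLocalGauge(Print) ∕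
TorusCoverPropSixGauge(10) ∕ TorusCoverLandau153(Print∕Box∕TwoWindow)` helpers, N05's `Node00.CarriersB8Cube` letters.  `--kind proof --supports stmt-QuantumFields-27364`
(K1⁹; count-neutral helper).  [6] = [Balaban1985RegularSpaces]; [15] = [Balaban1985Variational]; [3] = [Balaban1985Averaging]; [I] = [Balaban1987RG1].

WHY (⚑ LOCATED-REPRESENTATIVE-AXIAL-SURFACE, plan A2).  `Thm4AtOne` ∕ the γ-engine accept only MEMBER-axial input ([6] (1.15), corner tree-words of the [4]-averages), so
the only normalisation of [15] (152) «ū_j = 1 on Λ′_j» reachable from [6] as typed is the member's own conj. 3 `Restr129 L k ℭ_k 1 u_m` for the gauge `u_m` of the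
member-axial copy `U″ = (zdLift U)^{v_fix}` cut to `□̃`; the knit's text of record `NrmMem` says «the torus gauge is the push-down of `u_m⁻¹·v_fix` on `□₀`, `u_m ∈ SU(N)`, `= 1`
off `□₀`, (1.29)-normalised».  The g0–g7 doors DROP conj. 2∕3∕11 and hide the relation `s = w⁻¹ = u_m⁻¹·v_fix` inside the `U(N) → SU(N)` normalisation; THIS FILE keeps and
exports them, for an `SU(N)`-valued member gauge (print p. 76 «G = SU(N)»; the `G`-valued γ-chain of dag-n05-e g33, or plan A2's item (j) `det u_m ≡ 1` on `GaugedBoundB8`'s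
own clauses), where FILE 3b″ §2 makes the normalisation TRIVIAL (`s = w⁻¹` verbatim, `tr A = 0`).

THE HYPOTHESIS SHAPE (no new definition).  `hG` = the ∃-body of `Node00.GaugedBoundB8 L η V c r` VERBATIM (its eleven conjuncts, `CarriersB8Cube` :142–157) with conjunct 1
(`u x ∈ unitaryUnits`) and conjunct 6 (`(v_fix⁻¹·u) x ∈ unitaryUnits`) read at `specialUnitaryUnits (Fin N)` — exactly what `B8Prop6CubeMemberGaugedRealGammaG.
gaugedBoundB8Body_of_clauses_mem` delivers at `G := specialUnitaryUnits (Fin N)`, and what item (j) delivers from `GaugedBoundB8` at an `SU(N)`-valued `V`.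

WHAT IS PROVED (kernel; `P : Params` ∕ generic `d, L` for §1; `N ≥ 1`; no definition).
* §1 ★★ `exists_suGauge_letters152_tower_member` (on `ℤᵈ`, any `d ≥ 2`, `L ≥ 2`): from the SU ∃-body: `s : ℤᵈ → SU(N)` and the witness `u_m` with `ιSU (s x) = (u_m x)⁻¹·v_fix x`
  on `□₀`, the gauge equation `V^{ιSU∘s}(b) = e^{iη·logCfg η (U″^{u_m⁻¹})(b)}` on the bonds of `□₀`, [15] (152)'s level-weighted letters `‖·‖ ≤ 2r(Lʲη)⁻¹` on `□_j`, the four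
  top-box letters, `IsLandau138 … (logCfg η (U″^{u_m⁻¹}))`, `u_m ∈ SU(N)`, `u_m = 1` off `□₀`, `Restr129 L k ℭ_k 1 u_m`, and (1.137) — my g7 `…Tower` theorem with conj. 2∕3∕11 kept.
* §2 ★★★ `exists_localGauge152_tower_member` (the torus door, `P : Params`): push-down through `π = cover P` injective on `□̃` (`…TowerWindow`'s construction at `X := □₀`, `X_t := □`,
  `X′ := □̃`, `…TowerDoor`'s closure lemmas): a torus gauge `u : GaugeTransf P 0 (SU N)` and `A` with `…TowerDoor`'s seven rows VERBATIM, plus ★ `∀ x ∈ □₀, ιSU (u (π x)) =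
  (u_m x)⁻¹ · v_fix x`, ★ `∀ x ∈ □̃, ∀ μ, A ⟨π x, μ⟩ = logCfg η_n (U″^{u_m⁻¹}) x μ`, `u_m ∈ SU(N)`, `u_m = 1` off `□₀`, ★ `Restr129 P.L c.k c.lamS 1 u_m`, (1.137) for `u_m`.
HONEST FRAMING: bookkeeping (push-down) over my own g7 doors; the SU ∃-body is a HYPOTHESIS (N05's node in the `G = SU(N)` reading ∕ item (j)); nothing of [6] ∕ [15] analysis
asserted; no token ∕ stub ∕ K-item closed; N07 ∕ N05 NOT discharged; counts unmoved; one finite 𝕋⁴ programme at fixed ε — R4 closes the conditional finite-𝕋⁴ rung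
`BalabanLadder.UV` only; the YM mass gap (Clay) is NOT proved by any of this; nothing continuum ∕ ℝ⁴ ∕ OS.  No `sorry`, no `def`, no `instance`, no `notation`.

References: [6] Prop. 6 (1.135)–(1.138) p.99, (1.29) p.81, (1.131) p.99, p.98, p.76; [15] (144)–(153) pp.300–301; [3] (2) p.17, (78)–(81) p.30; [I] (0.1) p.251.
-/

noncomputable section

namespace Literature.MathematicalPhysics.QuantumFieldTheory.Balaban1983to89.Node00

open scoped Matrix.Norms.L2Operator
open Complex (I)
open B7Prop1Explicit (e e_apply)
open B7Prop1Local (InBox AgreeOn)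
open B7Prop2Explicit (unitaryUnits mem_unitaryUnits)
open B7Prop2SpecialUnitary (specialUnitaryUnits mem_specialUnitaryUnits)
open B8Ineq132 (covDerivFwd covDeriv BondTouches)
open B8Eq131Cubes (box cube tcube tLo tHi bLo bHi gs)
open B8Eq140Level (SideTouches sideTouches_of_bondTouches)
open B8Eq138LandauZd (logCfg covDivB covLap IsLandau138 IsLandau138W)
open B8Eq184Proof (cfgExp)
open B8LeafModelZd3 (mlogCfg)
open B8ScaledSupNorm (msup Bdd bondNorm)
open B8Eq146AExpansion (plaqCovDeriv plaqCovDeriv_eq_covDerivFwd)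
open B8Eq143PlaqExpansion (pdiv)
open B8Eq119TwistedAxial (Restr129)
open B15Eq112TorusCover (cover)
open B14DomainGeom (Pt)
open B12RegularSpaces111 (gaugeU expI grad)
open B6SectADomainsV1 (Domains)
open B6SectAOperatorsV1 (RE dsE QpE)
open Literature.MathematicalPhysics.QuantumFieldTheory.BalabanImbrieJaffe1984to88.BIJ85AxialPropagator411 (BondSpace)

variable {d N : ℕ} [NeZero N]

/-! ## §1  On `ℤᵈ`: the `SU(N)` gauge on the tower with the member gauge exported -/

section Member

variable {L K : ℕ} {Ω : ℕ → Set (B7Prop1Explicit.Site d)}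

/-- ★★ **[6] PROPOSITION 6's GAUGE ON THE WHOLE TOWER `□₀` WITH THE MEMBER GAUGE EXPORTED** — my g7 `exists_suGauge_letters152_tower_of_gaugedBoundB8` re-run from the
`SU(N)`-valued ∃-body of `GaugedBoundB8 L η V c r` (conjuncts 1 and 6 at `specialUnitaryUnits`; `η > 0`, `r ≥ 0`, per-bond window `4·(N r) < 2π`): ONE `s : ℤᵈ → SU(N)`, the
exponent `A′ := logCfg η (U″^{u_m⁻¹})` and the member witness `u_m` with — (i) `V^{ιSU∘s}(b) = cfgExp η A′ b` on every bond of `□₀`; (ii) `∀ j ≤ k`, `‖A′(b)‖ ≤ 2·(r·(Lʲη)⁻¹)` on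
bonds with both ends in `□_j`; (iii) the four top-box letters; (iv) `IsLandau138 L k η □₀ ℭ_k 1 A′`; (v) ★ `ιSU (s x) = (u_m x)⁻¹·v_fix x` on `□₀`; (vi) `u_m x ∈ SU(N)`, `u_m = 1`
off `□₀`, ★ `Restr129 L k ℭ_k 1 u_m` ([6] (1.29), corner prefactors), (1.137).
[cite: Balaban1985RegularSpaces, Prop. 6 (1.135)–(1.138) p.99, (1.29) p.81, (1.131) p.99, p.76; Balaban1985Variational, (144)–(153) pp.300–301; Balaban1985Averaging, (78)–(81) p.30] -/
theorem exists_suGauge_letters152_tower_member (hd : 2 ≤ d) (hL : 2 ≤ L) (c : CubeB8 d L K Ω)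
    (V : B7Prop1Explicit.Site d → Fin d → (MatA N)ˣ) (hV : ∀ x μ, V x μ ∈ specialUnitaryUnits (Fin N)) {η r : ℝ} (hη : 0 < η) (hr : 0 ≤ r)
    (hG : letI : CStarAlgebra (MatA N) := {};
      ∃ u : B7Prop1Explicit.Site d → (MatA N)ˣ, (∀ x, u x ∈ specialUnitaryUnits (Fin N)) ∧ (∀ x, x ∉ c.sq 0 → u x = 1) ∧
        Restr129 L c.k c.lamS (1 : B7Prop1Explicit.Site d → Fin d → (MatA N)ˣ) u ∧
        IsLandau138W L c.k η (c.sq 0) c.lamS (1 : B7Prop1Explicit.Site d → Fin d → (MatA N)ˣ) (c.fixed V u) ∧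
        (∀ j, j ≤ c.k → ∀ b ∈ {b : B7Prop1Explicit.Site d × Fin d | SideTouches (c.sq j) b.1 b.2},
          c.fixed V u b.1 b.2 = cfgExp η (logCfg η (c.fixed V u)) b.1 b.2 ∧ IsSelfAdjoint (logCfg η (c.fixed V u) b.1 b.2) ∧
            ‖logCfg η (c.fixed V u) b.1 b.2‖ ≤ r * ((L : ℝ) ^ j * η)⁻¹) ∧
        (∀ x, ((c.vfix V)⁻¹ * u) x ∈ specialUnitaryUnits (Fin N)) ∧
        AgreeOn (B8Ineq130.tlo L (tLo c.a c.ρ) c.k) (B8Ineq130.thi L (tHi c.a c.M c.ρ) c.k) (B7Prop1Explicit.gaugeAct ((c.vfix V)⁻¹ * u)⁻¹ V) (c.fixed V u) ∧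
        msup L c.k η (-(2 : ℝ)) (fun j (t : Fin d × Fin d × B7Prop1Explicit.Site d) => SideTouches (c.sq j) t.2.2 t.2.1)
            (fun t => covDerivFwd η (1 : B7Prop1Explicit.Site d → Fin d → (MatA N)ˣ) t.1 (fun z => c.expo η V u z t.2.1) t.2.2) ≤ r ∧
        bondNorm L c.k η (-(3 : ℝ)) c.sq
            (fun x μ => pdiv η (1 : B7Prop1Explicit.Site d → Fin d → (MatA N)ˣ) (plaqCovDeriv η (1 : B7Prop1Explicit.Site d → Fin d → (MatA N)ˣ) (c.expo η V u)) μ x) ≤ r ∧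
        bondNorm L c.k η (-(3 : ℝ)) c.sq (fun x μ => covLap η (1 : B7Prop1Explicit.Site d → Fin d → (MatA N)ˣ) (fun z => c.expo η V u z μ) x) ≤ r ∧
        (∀ (x : B7Prop1Explicit.Site d) (μ : Fin d), bLo L c.a 0 0 ≤ x → x + e μ ≤ bHi L c.a c.M 0 0 →
          B7Prop4GeneralLevels.logCovIter L (1 : B7Prop1Explicit.Site d → Fin d → (MatA N)ˣ) (B8Eq146AExpansion.iEta η (c.expo η V u)) c.k x μ =
            MatrixLog.mlog ((B7Prop2Explicit.avgIter L (c.axial V) c.k x μ : (MatA N)ˣ) : MatA N)))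
    (hsmall : 4 * ((N : ℝ) * r) < 2 * Real.pi) :
    letI : CStarAlgebra (MatA N) := {}
    ∃ s : B7Prop1Explicit.Site d → Matrix.specialUnitaryGroup (Fin N) ℂ, ∃ um : B7Prop1Explicit.Site d → (MatA N)ˣ,
      (∀ x μ, x ∈ c.sq 0 → x + e μ ∈ c.sq 0 →
          B7Prop1Explicit.gaugeAct (fun y => ιSU N (s y)) V x μ = cfgExp η (logCfg η (c.fixed V um)) x μ) ∧
      (∀ j, j ≤ c.k → ∀ x μ, x ∈ c.sq j → x + e μ ∈ c.sq j → ‖logCfg η (c.fixed V um) x μ‖ ≤ 2 * (r * ((L : ℝ) ^ j * η)⁻¹)) ∧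
      (∀ x μ, x ∈ box L c.a c.M c.k → x + e μ ∈ box L c.a c.M c.k → ‖logCfg η (c.fixed V um) x μ‖ ≤ 2 * (r * ((L : ℝ) ^ c.k * η)⁻¹)) ∧
      (∀ x μ ν, x ∈ box L c.a c.M c.k → x + e μ ∈ box L c.a c.M c.k → x + e ν ∈ box L c.a c.M c.k →
          ‖logCfg η (c.fixed V um) (x + e μ) ν - logCfg η (c.fixed V um) x ν‖ ≤ 2 * (η * r * (((L : ℝ) ^ c.k * η) ^ 2)⁻¹)) ∧
      (∀ x μ, x ∈ box L c.a c.M c.k → x + e μ ∈ box L c.a c.M c.k →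
          (∀ ν, x + e ν ∈ box L c.a c.M c.k ∧ x - e ν ∈ box L c.a c.M c.k ∧ x - e ν + e μ ∈ box L c.a c.M c.k) →
          ‖pdiv η (1 : B7Prop1Explicit.Site d → Fin d → (MatA N)ˣ) (plaqCovDeriv η 1 (logCfg η (c.fixed V um))) μ x‖ ≤ 2 * (r * (((L : ℝ) ^ c.k * η) ^ 3)⁻¹)) ∧
      (∀ x μ, x ∈ box L c.a c.M c.k → x + e μ ∈ box L c.a c.M c.k → (∀ ν, x + e ν ∈ box L c.a c.M c.k ∧ x - e ν ∈ box L c.a c.M c.k) →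
          ‖covLap η (1 : B7Prop1Explicit.Site d → Fin d → (MatA N)ˣ) (fun z => logCfg η (c.fixed V um) z μ) x‖ ≤ 2 * (r * (((L : ℝ) ^ c.k * η) ^ 3)⁻¹)) ∧
      IsLandau138 L c.k η (c.sq 0) c.lamS (1 : B7Prop1Explicit.Site d → Fin d → (MatA N)ˣ) (logCfg η (c.fixed V um)) ∧
      (∀ x, x ∈ c.sq 0 → ιSU N (s x) = (um x)⁻¹ * c.vfix V x) ∧
      (∀ x, um x ∈ specialUnitaryUnits (Fin N)) ∧ (∀ x, x ∉ c.sq 0 → um x = 1) ∧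
      Restr129 L c.k c.lamS (1 : B7Prop1Explicit.Site d → Fin d → (MatA N)ˣ) um ∧
      (∀ (x : B7Prop1Explicit.Site d) (μ : Fin d), bLo L c.a 0 0 ≤ x → x + e μ ≤ bHi L c.a c.M 0 0 →
        B7Prop4GeneralLevels.logCovIter L (1 : B7Prop1Explicit.Site d → Fin d → (MatA N)ˣ) (B8Eq146AExpansion.iEta η (c.expo η V um)) c.k x μ =
          MatrixLog.mlog ((B7Prop2Explicit.avgIter L (c.axial V) c.k x μ : (MatA N)ˣ) : MatA N)) := by
  letI : CStarAlgebra (MatA N) := {}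
  have hL1 : 1 ≤ L := le_trans (by norm_num) hL
  have hρ1 : 1 ≤ c.ρ := le_trans hL1 c.L_le_ρ
  obtain ⟨u, hu, hoff, h129, h138, h162, hw, h135, h136₂, h136₃, h136₄, h137⟩ := hG
  set w : B7Prop1Explicit.Site d → (MatA N)ˣ := (c.vfix V)⁻¹ * u with hwdef
  set U₁ : B7Prop1Explicit.Site d → Fin d → (MatA N)ˣ := c.fixed V u with hU₁
  have h138' : IsLandau138 L c.k η (c.sq 0) c.lamS (1 : B7Prop1Explicit.Site d → Fin d → (MatA N)ˣ) (logCfg η U₁) := h138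
  have h136' : ∀ j, j ≤ c.k → ∀ b ∈ {b : B7Prop1Explicit.Site d × Fin d | SideTouches (c.sq j) b.1 b.2},
      ‖logCfg η U₁ b.1 b.2‖ ≤ r * ((L : ℝ) ^ j * η)⁻¹ := fun j hj b hb => (h162 j hj b hb).2.2
  -- `□₀` as an `InBox`, inside `□̃`
  set lo₀ : B7Prop1Explicit.Site d := bLo L c.a c.k (c.ρ * gs L c.k) with hlo₀
  set hi₀ : B7Prop1Explicit.Site d := bHi L c.a c.M c.k (c.ρ * gs L c.k) with hhi₀
  have hsq : ∀ x, InBox lo₀ hi₀ x ↔ x ∈ c.sq 0 := fun x => (mem_sq_zero_iff_inBox c x).symm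
  have hsqT : c.sq 0 ⊆ tcube L c.a c.M c.ρ c.k := by
    have h0 : c.sq 0 = cube L c.a c.M c.ρ c.k 0 := B8Eq131CubesAdmissible.cubeFam_false_zero L c.a c.M c.ρ c.k
    rw [h0]
    exact B8Eq131Cubes.cube_subset_tcube hL hρ1 (Nat.zero_le _)
  -- the data of FILE 3b″ §2 on the box `□₀`: `w⁻¹` is `SU(N)`-valued
  have hg : ∀ x, InBox lo₀ hi₀ x → w⁻¹ x ∈ specialUnitaryUnits (Fin N) := fun x _ => by
    rw [Pi.inv_apply]; exact (specialUnitaryUnits (Fin N)).inv_mem (hw x)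
  have hgauge : ∀ x μ, InBox lo₀ hi₀ x → InBox lo₀ hi₀ (x + e μ) → B7Prop1Explicit.gaugeAct w⁻¹ V x μ = cfgExp η (logCfg η U₁) x μ := by
    intro x μ hx hx'
    have hx0 := (hsq x).1 hx
    rw [h135 x μ (hsqT hx0) (hsqT ((hsq _).1 hx'))]
    exact (h162 0 (Nat.zero_le _) (x, μ) (sideTouches_sq_of_mem hd c 0 hx0 μ)).1
  have hsa : ∀ x μ, InBox lo₀ hi₀ x → InBox lo₀ hi₀ (x + e μ) → IsSelfAdjoint (logCfg η U₁ x μ) := fun x μ hx _ =>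
    (h162 0 (Nat.zero_le _) (x, μ) (sideTouches_sq_of_mem hd c 0 ((hsq x).1 hx) μ)).2.1
  have hA : ∀ x μ, InBox lo₀ hi₀ x → InBox lo₀ hi₀ (x + e μ) → η * (N * ‖logCfg η U₁ x μ‖) ≤ N * r := by
    intro x μ hx _
    have h := h136' 0 (Nat.zero_le _) (x, μ) (sideTouches_sq_of_mem hd c 0 ((hsq x).1 hx) μ)
    simp only [pow_zero, one_mul] at h
    have hN : (0 : ℝ) ≤ N := Nat.cast_nonneg N
    calc η * (N * ‖logCfg η U₁ x μ‖) ≤ η * (N * (r * η⁻¹)) := mul_le_mul_of_nonneg_left (mul_le_mul_of_nonneg_left h hN) hη.le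
      _ = N * r := by field_simp
  have hVdet : ∀ x μ, InBox lo₀ hi₀ x → InBox lo₀ hi₀ (x + e μ) → ((V x μ : (MatA N)ˣ) : MatA N).det = 1 := fun x μ _ _ =>
    (Matrix.mem_specialUnitaryGroup_iff.1 (hV x μ)).2
  obtain ⟨s, hs, -, hsg⟩ := exists_suGauge_of_specialUnitaryGauge_local lo₀ hi₀ hη V w⁻¹ (logCfg η U₁) hVdet hg hgauge hsa hA hsmall
  -- top-box letters (generation 0, verbatim)
  have hAtop : ∀ x μ, InBox (bLo L c.a c.k 0) (bHi L c.a c.M c.k 0) x → InBox (bLo L c.a c.k 0) (bHi L c.a c.M c.k 0) (x + e μ) →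
      ‖logCfg η U₁ x μ‖ ≤ r * ((L : ℝ) ^ c.k * η)⁻¹ := fun x μ hx _ => h136' c.k le_rfl (x, μ) (sideTouches_sq_top_of_mem_box c hd hx μ)
  -- weakening `t ≤ 2t` for the nonnegative letters
  have h2 : ∀ {a t : ℝ}, 0 ≤ t → a ≤ t → a ≤ 2 * t := fun ht h => h.trans (by linarith)
  have hLη : ∀ j : ℕ, 0 ≤ r * ((L : ℝ) ^ j * η)⁻¹ := fun j => by positivity
  refine ⟨s, u, fun x μ hx hx' => hsg x μ ((hsq x).2 hx) ((hsq _).2 hx'), fun j hj x μ hx hx' => ?_, fun x μ hx hx' => ?_, fun x μ ν hx hx' _ => ?_,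
    fun x μ hx hx' hν => ?_, fun x μ hx _ hν => ?_, h138', fun x hx => ?_, hu, hoff, h129, h137⟩
  · exact h2 (hLη j) (h136' j hj (x, μ) (sideTouches_sq_of_mem hd c j hx μ))
  · exact h2 (hLη c.k) (hAtop x μ hx hx')
  · exact h2 (by positivity) (norm_sub_le_of_msup_grad c hd hL1 hη hr U₁ h136' h136₂ hx hx')
  · exact h2 (by positivity) (norm_codiff_logCfg_le c hd hL1 hη hr U₁ h136' h136₃ hx hx' hν)
  · exact h2 (by positivity) (norm_lap_logCfg_le c hd hL1 hη hr U₁ h136' h136₄ hx hν μ)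
  · rw [hs x ((hsq x).2 hx), hwdef]
    simp only [Pi.inv_apply, Pi.mul_apply, mul_inv_rev, inv_inv]

end Member

/-! ## §2  The torus door with the member gauge exported -/

section TowerMember

variable {P : Params}

/-- ★★★ **THE (152)+(153) TOWER DOOR WITH THE MEMBER GAUGE EXPORTED** (plan A2 Part I (d₂)) — my g7 `exists_localGauge152_tower_of_gaugedBoundB8` re-run from the `SU(N)`-valued
∃-body of `GaugedBoundB8 P.L η_n (zdLift N U) c r` (conjuncts 1, 6 at `specialUnitaryUnits`), `InjOn π □̃`, `4·(N r) < 2π`: a torus gauge `u : GaugeTransf P 0 (SU N)` and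
`A : PBond P 0 → M_N(ℂ)` with `…TowerDoor`'s seven rows VERBATIM (gauge equation on `π(□₀)`, level-weighted (152) letters on `π(□_j)`, the four top-box letters on `π(□)`, the
(153)-gauged lift `A′ = logCfg η_n (U″^{u_m⁻¹})` on `□̃` with `IsLandau138`), PLUS the member witness `u_m`: ★ `ιSU (u (π x)) = (u_m x)⁻¹·v_fix x` on `□₀`, `u_m ∈ SU(N)`, `u_m = 1`
off `□₀`, ★ `Restr129 P.L c.k ℭ_k 1 u_m` ([6] (1.29), corner prefactors, flat), (1.137) — the rows of the K0 knit's `NrmMem`.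
[cite: Balaban1985RegularSpaces, Prop. 6 (1.135)–(1.138) p.99, (1.29) p.81, (1.131) p.99, p.98, p.76; Balaban1985Variational, (144) p.300, (152)–(153) p.301; Balaban1987RG1, (0.1) p.251] -/
theorem exists_localGauge152_tower_member (hd : 2 ≤ P.d) {K' : ℕ} {Ω' : ℕ → Set (B7Prop1Explicit.Site P.d)} (c : CubeB8 P.d P.L K' Ω')
    (U : GaugeField P 0 (SU N)) {n : ℕ} (hk : c.k = n) {r : ℝ} (hr : 0 ≤ r)
    (hG : letI : CStarAlgebra (MatA N) := {};
      ∃ u : B7Prop1Explicit.Site P.d → (MatA N)ˣ, (∀ x, u x ∈ specialUnitaryUnits (Fin N)) ∧ (∀ x, x ∉ c.sq 0 → u x = 1) ∧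
        Restr129 P.L c.k c.lamS (1 : B7Prop1Explicit.Site P.d → Fin P.d → (MatA N)ˣ) u ∧
        IsLandau138W P.L c.k (P.eta n) (c.sq 0) c.lamS (1 : B7Prop1Explicit.Site P.d → Fin P.d → (MatA N)ˣ) (c.fixed (zdLift N U) u) ∧
        (∀ j, j ≤ c.k → ∀ b ∈ {b : B7Prop1Explicit.Site P.d × Fin P.d | SideTouches (c.sq j) b.1 b.2},
          c.fixed (zdLift N U) u b.1 b.2 = cfgExp (P.eta n) (logCfg (P.eta n) (c.fixed (zdLift N U) u)) b.1 b.2 ∧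
            IsSelfAdjoint (logCfg (P.eta n) (c.fixed (zdLift N U) u) b.1 b.2) ∧
            ‖logCfg (P.eta n) (c.fixed (zdLift N U) u) b.1 b.2‖ ≤ r * ((P.L : ℝ) ^ j * P.eta n)⁻¹) ∧
        (∀ x, ((c.vfix (zdLift N U))⁻¹ * u) x ∈ specialUnitaryUnits (Fin N)) ∧
        AgreeOn (B8Ineq130.tlo P.L (tLo c.a c.ρ) c.k) (B8Ineq130.thi P.L (tHi c.a c.M c.ρ) c.k)
          (B7Prop1Explicit.gaugeAct ((c.vfix (zdLift N U))⁻¹ * u)⁻¹ (zdLift N U)) (c.fixed (zdLift N U) u) ∧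
        msup P.L c.k (P.eta n) (-(2 : ℝ)) (fun j (t : Fin P.d × Fin P.d × B7Prop1Explicit.Site P.d) => SideTouches (c.sq j) t.2.2 t.2.1)
            (fun t => covDerivFwd (P.eta n) (1 : B7Prop1Explicit.Site P.d → Fin P.d → (MatA N)ˣ) t.1 (fun z => c.expo (P.eta n) (zdLift N U) u z t.2.1) t.2.2) ≤ r ∧
        bondNorm P.L c.k (P.eta n) (-(3 : ℝ)) c.sq
            (fun x μ => pdiv (P.eta n) (1 : B7Prop1Explicit.Site P.d → Fin P.d → (MatA N)ˣ)
              (plaqCovDeriv (P.eta n) (1 : B7Prop1Explicit.Site P.d → Fin P.d → (MatA N)ˣ) (c.expo (P.eta n) (zdLift N U) u)) μ x) ≤ r ∧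
        bondNorm P.L c.k (P.eta n) (-(3 : ℝ)) c.sq
            (fun x μ => covLap (P.eta n) (1 : B7Prop1Explicit.Site P.d → Fin P.d → (MatA N)ˣ) (fun z => c.expo (P.eta n) (zdLift N U) u z μ) x) ≤ r ∧
        (∀ (x : B7Prop1Explicit.Site P.d) (μ : Fin P.d), bLo P.L c.a 0 0 ≤ x → x + e μ ≤ bHi P.L c.a c.M 0 0 →
          B7Prop4GeneralLevels.logCovIter P.L (1 : B7Prop1Explicit.Site P.d → Fin P.d → (MatA N)ˣ) (B8Eq146AExpansion.iEta (P.eta n) (c.expo (P.eta n) (zdLift N U) u)) c.k x μ =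
            MatrixLog.mlog ((B7Prop2Explicit.avgIter P.L (c.axial (zdLift N U)) c.k x μ : (MatA N)ˣ) : MatA N)))
    (hinj : Set.InjOn (cover P) (tcube P.L c.a c.M c.ρ c.k)) (h4 : 4 * ((N : ℝ) * r) < 2 * Real.pi) :
    letI : CStarAlgebra (MatA N) := {}
    ∃ u : GaugeTransf P 0 (SU N), ∃ A : PBond P 0 → MatA N, ∃ um : B7Prop1Explicit.Site P.d → (MatA N)ˣ,
      (∀ b ∈ (Sect2.regionOfSet P (cover P '' c.sq 0)).bonds, gaugeU (fun x => ιSU N (u x)) (fun b' => ιSU N (U b')) b = expI (P.eta n) (A b)) ∧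
      (∀ j, j ≤ c.k → ∀ (x : Pt P.d) (μ : Fin P.d), x ∈ c.sq j → x + e μ ∈ c.sq j → ‖A ⟨cover P x, μ⟩‖ ≤ 2 * (r * ((P.L : ℝ) ^ j * P.eta n)⁻¹)) ∧
      (∀ b ∈ (Sect2.regionOfSet P (cover P '' box P.L c.a c.M c.k)).bonds, ‖A b‖ ≤ 2 * r) ∧
      (∀ q ∈ (Sect2.regionOfSet P (cover P '' box P.L c.a c.M c.k)).dpairs, ‖grad (P.eta n) q.2.1 (fun y => A ⟨y, q.2.2⟩) q.1‖ ≤ 2 * r) ∧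
      (∀ b ∈ Sect2.bondsDeep (cover P '' box P.L c.a c.M c.k), ‖Sect2.codiffCurlA (P.eta n) A b.src b.dir‖ ≤ 2 * r) ∧
      (∀ b ∈ Sect2.bondsDeep (cover P '' box P.L c.a c.M c.k),
          ‖∑ ν : Fin P.d, ((P.eta n : ℝ) : ℂ)⁻¹ •
              (grad (P.eta n) ν (fun y => A ⟨y, b.dir⟩) (b.src.unshift ν) - grad (P.eta n) ν (fun y => A ⟨y, b.dir⟩) b.src)‖ ≤ 2 * r) ∧
      (∀ x, x ∈ tcube P.L c.a c.M c.ρ c.k → ∀ μ, A ⟨cover P x, μ⟩ = logCfg (P.eta n) (c.fixed (zdLift N U) um) x μ) ∧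
      IsLandau138 P.L c.k (P.eta n) (c.sq 0) c.lamS (1 : B7Prop1Explicit.Site P.d → Fin P.d → (MatA N)ˣ) (logCfg (P.eta n) (c.fixed (zdLift N U) um)) ∧
      (∀ x, x ∈ c.sq 0 → ιSU N (u (cover P x)) = (um x)⁻¹ * c.vfix (zdLift N U) x) ∧
      (∀ x, um x ∈ specialUnitaryUnits (Fin N)) ∧ (∀ x, x ∉ c.sq 0 → um x = 1) ∧
      Restr129 P.L c.k c.lamS (1 : B7Prop1Explicit.Site P.d → Fin P.d → (MatA N)ˣ) um ∧
      (∀ (x : B7Prop1Explicit.Site P.d) (μ : Fin P.d), bLo P.L c.a 0 0 ≤ x → x + e μ ≤ bHi P.L c.a c.M 0 0 →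
        B7Prop4GeneralLevels.logCovIter P.L (1 : B7Prop1Explicit.Site P.d → Fin P.d → (MatA N)ˣ) (B8Eq146AExpansion.iEta (P.eta n) (c.expo (P.eta n) (zdLift N U) um)) c.k x μ =
          MatrixLog.mlog ((B7Prop2Explicit.avgIter P.L (c.axial (zdLift N U)) c.k x μ : (MatA N)ˣ) : MatA N)) := by
  classical
  letI : CStarAlgebra (MatA N) := {}
  have hL : 2 ≤ P.L := P.hL.2
  have hρ1 : 1 ≤ c.ρ := le_trans (le_trans (by norm_num) hL) c.L_le_ρ
  have hηpos : 0 < P.eta n := B3GkZeroTorusRescaled.eta_pos P n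
  set V := zdLift N U with hV
  obtain ⟨s, um, h1, hlev, h2, h3, h4c, h4', h5, hsid, hsu, hoff, h129, h137⟩ :=
    exists_suGauge_letters152_tower_member hd hL c V (zdLift_mem_specialUnitaryUnits U) hηpos hr hG h4
  have hscale : (P.L : ℝ) ^ c.k * P.eta n = 1 := by rw [hk]; exact B12Eq115BackgroundPair.pow_mul_eta P n
  simp only [hscale, inv_one, mul_one, one_pow] at h2 h3 h4c h4'
  -- the three windows of `…TowerDoor`: `X := □₀`, `X_t := □`, `X′ := □̃`
  set A' : B7Prop1Explicit.Site P.d → Fin P.d → MatA N := logCfg (P.eta n) (c.fixed V um) with hA'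
  have h0 : c.sq 0 = cube P.L c.a c.M c.ρ c.k 0 := B8Eq131CubesAdmissible.cubeFam_false_zero P.L c.a c.M c.ρ c.k
  have hsqT : c.sq 0 ⊆ tcube P.L c.a c.M c.ρ c.k := by
    rw [h0]; exact B8Eq131Cubes.cube_subset_tcube hL hρ1 (Nat.zero_le _)
  have hinj0 : Set.InjOn (cover P) (c.sq 0) := hinj.mono hsqT
  have hbox : box P.L c.a c.M c.k ⊆ c.sq 0 := box_subset_sq_zero c
  have hinjt : Set.InjOn (cover P) (box P.L c.a c.M c.k) := hinj0.mono hbox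
  have hfwd : ∀ ⦃x⦄, x ∈ c.sq 0 → ∀ μ, (cover P x).shift μ ∈ cover P '' c.sq 0 → x + e μ ∈ c.sq 0 :=
    fun _ hx _ h => add_e_mem_sq_zero_of_shift_mem_image_of_injOn_tcube c hinj hx h
  have hfwdt : ∀ ⦃x⦄, x ∈ box P.L c.a c.M c.k → ∀ μ, (cover P x).shift μ ∈ cover P '' box P.L c.a c.M c.k → x + e μ ∈ box P.L c.a c.M c.k :=
    fun _ hx _ h => add_e_mem_box_of_shift_mem_image_of_injOn c hinj0 hx h
  have hbwdt : ∀ ⦃x⦄, x ∈ box P.L c.a c.M c.k → ∀ ν, (cover P x).unshift ν ∈ cover P '' box P.L c.a c.M c.k → x - e ν ∈ box P.L c.a c.M c.k :=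
    fun _ hx _ h => sub_e_mem_box_of_unshift_mem_image_of_injOn c hinj0 hx h
  -- push-down through the cover, injective on `□̃`
  let u : GaugeTransf P 0 (SU N) := fun y =>
    if h : ∃ x, x ∈ tcube P.L c.a c.M c.ρ c.k ∧ cover P x = y then s (Classical.choose h) else 1
  let A : PBond P 0 → MatA N := fun b =>
    if h : ∃ x, x ∈ tcube P.L c.a c.M c.ρ c.k ∧ cover P x = b.src then A' (Classical.choose h) b.dir else 0
  have hu : ∀ x, x ∈ tcube P.L c.a c.M c.ρ c.k → u (cover P x) = s x := by
    intro x hx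
    have hex : ∃ x', x' ∈ tcube P.L c.a c.M c.ρ c.k ∧ cover P x' = cover P x := ⟨x, hx, rfl⟩
    simp only [u, dif_pos hex]
    rw [hinj (Classical.choose_spec hex).1 hx (Classical.choose_spec hex).2]
  have hA : ∀ x, x ∈ tcube P.L c.a c.M c.ρ c.k → ∀ μ, A ⟨cover P x, μ⟩ = A' x μ := by
    intro x hx μ
    have hex : ∃ x', x' ∈ tcube P.L c.a c.M c.ρ c.k ∧ cover P x' = cover P x := ⟨x, hx, rfl⟩
    simp only [A, dif_pos hex]
    rw [hinj (Classical.choose_spec hex).1 hx (Classical.choose_spec hex).2]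
  have hlift : ∀ y, y ∈ cover P '' c.sq 0 → ∃ x, x ∈ c.sq 0 ∧ cover P x = y := fun y ⟨x, hx, hxy⟩ => ⟨x, hx, hxy⟩
  have hliftt : ∀ y, y ∈ cover P '' box P.L c.a c.M c.k → ∃ x, x ∈ box P.L c.a c.M c.k ∧ cover P x = y := fun y ⟨x, hx, hxy⟩ => ⟨x, hx, hxy⟩
  have hXtX' : box P.L c.a c.M c.k ⊆ tcube P.L c.a c.M c.ρ c.k := hbox.trans hsqT
  refine ⟨u, A, um, fun b hb => ?_, fun j hj x μ hxj hxj' => ?_, fun b hb => ?_, fun q hq => ?_, fun b hb => ?_, fun b hb => ?_, hA, h5,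
    fun x hx => ?_, hsu, hoff, h129, h137⟩
  · obtain ⟨x, hx, hxs⟩ := hlift b.src hb.1
    have hx' : x + e b.dir ∈ c.sq 0 := hfwd hx b.dir (by rw [hxs]; exact hb.2)
    have hb' : b = ⟨cover P x, b.dir⟩ := by cases b; simp only at hxs; rw [hxs]
    rw [hb', hA x (hsqT hx)]
    have hgauge := h1 x b.dir hx hx'
    rw [cfgExp_eq_expI] at hgauge
    rw [← hgauge]
    simp only [gaugeU, B7Prop1Explicit.gaugeAct, PBond.tgt, ← cover_add_e, hu x (hsqT hx), hu (x + e b.dir) (hsqT hx'), hV, zdLift_apply]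
  · rw [hA x (hsqT (sq_subset_sq_zero c hj hxj))]
    exact hlev j hj x μ hxj hxj'
  · obtain ⟨x, hx, hxs⟩ := hliftt b.src hb.1
    have hx' : x + e b.dir ∈ box P.L c.a c.M c.k := hfwdt hx b.dir (by rw [hxs]; exact hb.2)
    have hb' : b = ⟨cover P x, b.dir⟩ := by cases b; simp only at hxs; rw [hxs]
    rw [hb', hA x (hXtX' hx)]
    exact h2 x b.dir hx hx'
  · obtain ⟨hq1, hq2, hq3, -⟩ := hq
    obtain ⟨x, hx, hxs⟩ := hliftt q.1 hq1
    have hxμ : x + e q.2.1 ∈ box P.L c.a c.M c.k := hfwdt hx q.2.1 (by rw [hxs]; exact hq2)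
    have hxν : x + e q.2.2 ∈ box P.L c.a c.M c.k := hfwdt hx q.2.2 (by rw [hxs]; exact hq3)
    rw [grad, ← hxs, ← cover_add_e, hA x (hXtX' hx), hA (x + e q.2.1) (hXtX' hxμ), norm_smul, norm_inv, Complex.norm_real, Real.norm_eq_abs,
      abs_of_pos hηpos]
    calc (P.eta n)⁻¹ * ‖A' (x + e q.2.1) q.2.2 - A' x q.2.2‖ ≤ (P.eta n)⁻¹ * (2 * (P.eta n * r)) :=
          mul_le_mul_of_nonneg_left (h3 x q.2.1 q.2.2 hx hxμ hxν) (inv_nonneg.2 hηpos.le)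
      _ = 2 * r := by field_simp
  · obtain ⟨hb1, hb2, hbν⟩ := hb
    obtain ⟨x, hx, hxs⟩ := hliftt b.src hb1
    have hxμ : x + e b.dir ∈ box P.L c.a c.M c.k := hfwdt hx b.dir (by rw [hxs]; exact hb2)
    have hstencil : ∀ ν, x + e ν ∈ box P.L c.a c.M c.k ∧ x - e ν ∈ box P.L c.a c.M c.k ∧ x - e ν + e b.dir ∈ box P.L c.a c.M c.k := by
      intro ν
      obtain ⟨s1, s2, s3, s4⟩ := hbν ν
      have hxν : x + e ν ∈ box P.L c.a c.M c.k := hfwdt hx ν (by rw [hxs]; exact s1)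
      have hxν' : x - e ν ∈ box P.L c.a c.M c.k := hbwdt hx ν (by rw [hxs]; exact s2)
      have hxν'' : x - e ν + e b.dir ∈ box P.L c.a c.M c.k :=
        hfwdt hxν' b.dir (by
          rw [cover_sub_e, hxs, ← Site.unshift_shift_comm]
          exact s4)
      exact ⟨hxν, hxν', hxν''⟩
    have hb' : b = ⟨cover P x, b.dir⟩ := by cases b; simp only at hxs; rw [hxs]
    rw [hb']
    show ‖Sect2.codiffCurlA (P.eta n) A (cover P x) b.dir‖ ≤ 2 * r
    have hAX : ∀ z, z ∈ box P.L c.a c.M c.k → ∀ κ, A ⟨cover P z, κ⟩ = A' z κ := fun z hz => hA z (hXtX' hz)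
    rw [codiffCurlA_cover_eq_pdiv_of_window (P.eta n) hAX hx hxμ hstencil]
    exact h4c x b.dir hx hxμ fun ν => ⟨(hstencil ν).1, (hstencil ν).2.1, (hstencil ν).2.2⟩
  · obtain ⟨hb1, hb2, hbν⟩ := hb
    obtain ⟨x, hx, hxs⟩ := hliftt b.src hb1
    have hxμ : x + e b.dir ∈ box P.L c.a c.M c.k := hfwdt hx b.dir (by rw [hxs]; exact hb2)
    have hstencil : ∀ ν, x + e ν ∈ box P.L c.a c.M c.k ∧ x - e ν ∈ box P.L c.a c.M c.k := by
      intro ν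
      obtain ⟨s1, s2, -, -⟩ := hbν ν
      exact ⟨hfwdt hx ν (by rw [hxs]; exact s1), hbwdt hx ν (by rw [hxs]; exact s2)⟩
    have hb' : b = ⟨cover P x, b.dir⟩ := by cases b; simp only at hxs; rw [hxs]
    rw [hb']
    show ‖∑ ν : Fin P.d, ((P.eta n : ℝ) : ℂ)⁻¹ •
        (grad (P.eta n) ν (fun y => A ⟨y, b.dir⟩) ((cover P x).unshift ν) - grad (P.eta n) ν (fun y => A ⟨y, b.dir⟩) (cover P x))‖ ≤ 2 * r
    have hAX : ∀ z, z ∈ box P.L c.a c.M c.k → ∀ κ, A ⟨cover P z, κ⟩ = A' z κ := fun z hz => hA z (hXtX' hz)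
    rw [lap_cover_eq_covLap_of_window (P.eta n) hAX hx hstencil]
    exact h4' x b.dir hx hxμ fun ν => ⟨(hstencil ν).1, (hstencil ν).2⟩
  · rw [hu x (hsqT hx)]
    exact hsid x hx

end TowerMember

/-! ## §3  The same with [15] (153) at every kernel-finer family (the knit's currency) -/

section Finer

variable {P : Params}

/-- ★★★ **THE MEMBER DOOR WITH (153) AT EVERY KERNEL-FINER FAMILY `D′`** — §2 with my g2∕g3 conversion `RE_dsE_re∕im_eq_zero_of_ker_le_cubeDomains` applied to its (153)-gauged
lift (`A ∘ π = logCfg η_n (U″^{u_m⁻¹})` on `□̃ ⊇ □₀`, `IsLandau138`): for every family `D′` of the torus with `ker Q′_{D′} ≤ ker Q′_{cubeDomains c}` (e.g. [15] (150)'s meet `□_j ∩ Ω_j`),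
`RE D′ η_n⁻¹ (dsE η_n⁻¹ (Re∕Im (φ ∘ A))) = 0` — ONE torus gauge `u`, ONE potential `A`, ONE member witness `u_m` for all such families, with all of §2's rows.
[cite: Balaban1985Variational, (150)–(153) p.301; Balaban1985RegularSpaces, Prop. 6 (1.135)–(1.138) p.99, (1.29) p.81, (1.38) p.82; Balaban1984PropagatorsII, (2.10)–(2.12) p.225; Balaban1987RG1, (0.1) p.251] -/
theorem exists_localGauge152_REfiner153_tower_member (hd : 2 ≤ P.d) {K' : ℕ} {Ω' : ℕ → Set (B7Prop1Explicit.Site P.d)} (c : CubeB8 P.d P.L K' Ω')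
    (U : GaugeField P 0 (SU N)) {n : ℕ} (hk : c.k = n) (hn : n ≤ P.m + P.K) {r : ℝ} (hr : 0 ≤ r)
    (hG : letI : CStarAlgebra (MatA N) := {};
      ∃ u : B7Prop1Explicit.Site P.d → (MatA N)ˣ, (∀ x, u x ∈ specialUnitaryUnits (Fin N)) ∧ (∀ x, x ∉ c.sq 0 → u x = 1) ∧
        Restr129 P.L c.k c.lamS (1 : B7Prop1Explicit.Site P.d → Fin P.d → (MatA N)ˣ) u ∧
        IsLandau138W P.L c.k (P.eta n) (c.sq 0) c.lamS (1 : B7Prop1Explicit.Site P.d → Fin P.d → (MatA N)ˣ) (c.fixed (zdLift N U) u) ∧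
        (∀ j, j ≤ c.k → ∀ b ∈ {b : B7Prop1Explicit.Site P.d × Fin P.d | SideTouches (c.sq j) b.1 b.2},
          c.fixed (zdLift N U) u b.1 b.2 = cfgExp (P.eta n) (logCfg (P.eta n) (c.fixed (zdLift N U) u)) b.1 b.2 ∧
            IsSelfAdjoint (logCfg (P.eta n) (c.fixed (zdLift N U) u) b.1 b.2) ∧
            ‖logCfg (P.eta n) (c.fixed (zdLift N U) u) b.1 b.2‖ ≤ r * ((P.L : ℝ) ^ j * P.eta n)⁻¹) ∧
        (∀ x, ((c.vfix (zdLift N U))⁻¹ * u) x ∈ specialUnitaryUnits (Fin N)) ∧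
        AgreeOn (B8Ineq130.tlo P.L (tLo c.a c.ρ) c.k) (B8Ineq130.thi P.L (tHi c.a c.M c.ρ) c.k)
          (B7Prop1Explicit.gaugeAct ((c.vfix (zdLift N U))⁻¹ * u)⁻¹ (zdLift N U)) (c.fixed (zdLift N U) u) ∧
        msup P.L c.k (P.eta n) (-(2 : ℝ)) (fun j (t : Fin P.d × Fin P.d × B7Prop1Explicit.Site P.d) => SideTouches (c.sq j) t.2.2 t.2.1)
            (fun t => covDerivFwd (P.eta n) (1 : B7Prop1Explicit.Site P.d → Fin P.d → (MatA N)ˣ) t.1 (fun z => c.expo (P.eta n) (zdLift N U) u z t.2.1) t.2.2) ≤ r ∧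
        bondNorm P.L c.k (P.eta n) (-(3 : ℝ)) c.sq
            (fun x μ => pdiv (P.eta n) (1 : B7Prop1Explicit.Site P.d → Fin P.d → (MatA N)ˣ)
              (plaqCovDeriv (P.eta n) (1 : B7Prop1Explicit.Site P.d → Fin P.d → (MatA N)ˣ) (c.expo (P.eta n) (zdLift N U) u)) μ x) ≤ r ∧
        bondNorm P.L c.k (P.eta n) (-(3 : ℝ)) c.sq
            (fun x μ => covLap (P.eta n) (1 : B7Prop1Explicit.Site P.d → Fin P.d → (MatA N)ˣ) (fun z => c.expo (P.eta n) (zdLift N U) u z μ) x) ≤ r ∧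
        (∀ (x : B7Prop1Explicit.Site P.d) (μ : Fin P.d), bLo P.L c.a 0 0 ≤ x → x + e μ ≤ bHi P.L c.a c.M 0 0 →
          B7Prop4GeneralLevels.logCovIter P.L (1 : B7Prop1Explicit.Site P.d → Fin P.d → (MatA N)ˣ) (B8Eq146AExpansion.iEta (P.eta n) (c.expo (P.eta n) (zdLift N U) u)) c.k x μ =
            MatrixLog.mlog ((B7Prop2Explicit.avgIter P.L (c.axial (zdLift N U)) c.k x μ : (MatA N)ˣ) : MatA N)))
    (hinj : Set.InjOn (cover P) (tcube P.L c.a c.M c.ρ c.k)) (h4 : 4 * ((N : ℝ) * r) < 2 * Real.pi) :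
    letI : CStarAlgebra (MatA N) := {}
    ∃ u : GaugeTransf P 0 (SU N), ∃ A : PBond P 0 → MatA N, ∃ um : B7Prop1Explicit.Site P.d → (MatA N)ˣ,
      (∀ b ∈ (Sect2.regionOfSet P (cover P '' c.sq 0)).bonds, gaugeU (fun x => ιSU N (u x)) (fun b' => ιSU N (U b')) b = expI (P.eta n) (A b)) ∧
      (∀ j, j ≤ c.k → ∀ (x : Pt P.d) (μ : Fin P.d), x ∈ c.sq j → x + e μ ∈ c.sq j → ‖A ⟨cover P x, μ⟩‖ ≤ 2 * (r * ((P.L : ℝ) ^ j * P.eta n)⁻¹)) ∧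
      (∀ b ∈ (Sect2.regionOfSet P (cover P '' box P.L c.a c.M c.k)).bonds, ‖A b‖ ≤ 2 * r) ∧
      (∀ q ∈ (Sect2.regionOfSet P (cover P '' box P.L c.a c.M c.k)).dpairs, ‖grad (P.eta n) q.2.1 (fun y => A ⟨y, q.2.2⟩) q.1‖ ≤ 2 * r) ∧
      (∀ b ∈ Sect2.bondsDeep (cover P '' box P.L c.a c.M c.k), ‖Sect2.codiffCurlA (P.eta n) A b.src b.dir‖ ≤ 2 * r) ∧
      (∀ b ∈ Sect2.bondsDeep (cover P '' box P.L c.a c.M c.k),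
          ‖∑ ν : Fin P.d, ((P.eta n : ℝ) : ℂ)⁻¹ •
              (grad (P.eta n) ν (fun y => A ⟨y, b.dir⟩) (b.src.unshift ν) - grad (P.eta n) ν (fun y => A ⟨y, b.dir⟩) b.src)‖ ≤ 2 * r) ∧
      (∀ D' : Domains P, LinearMap.ker (QpE D') ≤ LinearMap.ker (QpE (cubeDomains P c.a c.M c.ρ c.k (hk ▸ hn))) →
        ∀ φ : MatA N →L[ℂ] ℂ,
          RE D' (P.eta n)⁻¹ (dsE (P.eta n)⁻¹ (WithLp.toLp 2 fun b => (φ (A b)).re : BondSpace P)) = 0 ∧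
          RE D' (P.eta n)⁻¹ (dsE (P.eta n)⁻¹ (WithLp.toLp 2 fun b => (φ (A b)).im : BondSpace P)) = 0) ∧
      (∀ x, x ∈ tcube P.L c.a c.M c.ρ c.k → ∀ μ, A ⟨cover P x, μ⟩ = logCfg (P.eta n) (c.fixed (zdLift N U) um) x μ) ∧
      (∀ x, x ∈ c.sq 0 → ιSU N (u (cover P x)) = (um x)⁻¹ * c.vfix (zdLift N U) x) ∧
      (∀ x, um x ∈ specialUnitaryUnits (Fin N)) ∧ (∀ x, x ∉ c.sq 0 → um x = 1) ∧
      Restr129 P.L c.k c.lamS (1 : B7Prop1Explicit.Site P.d → Fin P.d → (MatA N)ˣ) um ∧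
      (∀ (x : B7Prop1Explicit.Site P.d) (μ : Fin P.d), bLo P.L c.a 0 0 ≤ x → x + e μ ≤ bHi P.L c.a c.M 0 0 →
        B7Prop4GeneralLevels.logCovIter P.L (1 : B7Prop1Explicit.Site P.d → Fin P.d → (MatA N)ˣ) (B8Eq146AExpansion.iEta (P.eta n) (c.expo (P.eta n) (zdLift N U) um)) c.k x μ =
          MatrixLog.mlog ((B7Prop2Explicit.avgIter P.L (c.axial (zdLift N U)) c.k x μ : (MatA N)ˣ) : MatA N)) := by
  letI : CStarAlgebra (MatA N) := {}
  have hL : 2 ≤ P.L := P.hL.2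
  have hρ1 : 1 ≤ c.ρ := le_trans (le_trans (by norm_num) hL) c.L_le_ρ
  have h0 : c.sq 0 = cube P.L c.a c.M c.ρ c.k 0 := B8Eq131CubesAdmissible.cubeFam_false_zero P.L c.a c.M c.ρ c.k
  have hsqT : c.sq 0 ⊆ tcube P.L c.a c.M c.ρ c.k := by
    rw [h0]; exact B8Eq131Cubes.cube_subset_tcube hL hρ1 (Nat.zero_le _)
  have hinj0 : Set.InjOn (cover P) (c.sq 0) := hinj.mono hsqT
  obtain ⟨u, A, um, h1, hlev, h2, h3, h4c, h4', hA, h138, hsid, hsu, hoff, h129, h137⟩ :=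
    exists_localGauge152_tower_member hd c U hk hr hG hinj h4
  have h6 : ∃ A' : B7Prop1Explicit.Site P.d → Fin P.d → MatA N, (∀ x, x ∈ c.sq 0 → ∀ μ, A ⟨cover P x, μ⟩ = A' x μ) ∧
      IsLandau138 P.L c.k (P.eta n) (c.sq 0) c.lamS (1 : B7Prop1Explicit.Site P.d → Fin P.d → (MatA N)ˣ) A' :=
    ⟨_, fun x hx μ => hA x (hsqT hx) μ, h138⟩
  exact ⟨u, A, um, h1, hlev, h2, h3, h4c, h4', fun D' hD' φ =>
    ⟨RE_dsE_re_eq_zero_of_ker_le_cubeDomains c (hk ▸ hn) hinj0 h6 hD' φ, RE_dsE_im_eq_zero_of_ker_le_cubeDomains c (hk ▸ hn) hinj0 h6 hD' φ⟩,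
    hA, hsid, hsu, hoff, h129, h137⟩

end Finer

end Literature.MathematicalPhysics.QuantumFieldTheory.Balaban1983to89.Node00

end
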